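import Summits.HubbardSuperconductivity.HubbardSuperconductivity.Theorems.AnisotropyChordInsertionEntropyOneState
import Summits.HubbardSuperconductivity.HubbardSuperconductivity.Theorems.AnisotropyChordInsertionEntropyJDiv

/-!
# Route `AnisotropyChord` / H0 rotor rung: the teleportation entropy of JASTROW (Rokhsar–Kivelson) states is a
# classical SCREENING quantity (theory seat `hubbard-h0-rotor-theory-1`, cycle 9, memo ROTOR-THEORY-9 §135;
# Sketch9 Parts F–G ported)

* **J1** `klDiv_teleLaw_eq` : for a positive amplitude with `a_{yx} = a_{xy}`,
  `KL(ν_x^{(y)} ‖ ν_y^{(x)}) = E_{ν_x^{(y)}} [2 log ψ(τ+x) − 2 log ψ(τ+y)]`;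
* `spectatorField w τ x = Φ_τ(x) = Σ_z n_z(τ) w(z,x)`, `jastrowLogWeight`, `jastrowAmp w = exp(−J/4)` (so `|ψ_w|²` is
  the Gibbs weight of the classical lattice gas with pair potential `w`); insertion rules `spectatorField_update`,
  `jastrowLogWeight_update`;
* **J2** `klDiv_teleLaw_jastrow` : `KL(ν_x^{(y)} ‖ ν_y^{(x)}) = E_{ν_x^{(y)}} [Φ_τ(y) − Φ_τ(x)]` — the relative entropy
  that decides condensation (`TeleEntropyBound`) is the mean spectator-potential shift between the pinned vacancy and
  the pinned particle; `klDiv_teleLaw_jastrow_le` (screening bound ⇒ entropy bound);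
* invariance under `w`-preserving relabellings and **`pairMass_symm_of_reflection`** (`a_{yx} = a_{xy}` from a
  reflection swapping `x` and `y`);
* **J3** `klDiv_teleLaw_jastrow_density` (`KL = Σ_z condOcc(z)·(w(z,y) − w(z,x))`, linear in the conditioned
  density `condOcc`) and **J3′** `klDiv_teleLaw_jastrow_cloud` (translation-invariant `w`: only the screening cloud
  `condOcc − m` is seen).
The occupation indicator is the tree's `occ`.  Nothing here refers to a Hamiltonian.
-/

set_option linter.dupNamespace false

noncomputable section

open Finset

namespace Summit.HubbardSuperconductivity.HubbardSuperconductivity.Theorems.AnisotropyChord.InsertionEntropy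

section OneStateJastrow

variable {V : Type} [Fintype V] [DecidableEq V]

/-- A configuration with `τ x = τ y = 1` contributes a positive term to `a_{xy}`, so `a_{xy} > 0` for positive
amplitudes. [folklore] -/
theorem pairMass_pos_of_pos (a : (V → Fin 2) → ℝ) (hpos : ∀ σ, 0 < a σ) (x y : V) (τ : V → Fin 2)
    (h : τ x = 1 ∧ τ y = 1) : 0 < pairMass a x y := by
  unfold pairMass
  have hle : (if τ x = 1 ∧ τ y = 1 then a (Function.update τ x 0) ^ 2 else 0)
      ≤ ∑ τ' : V → Fin 2, (if τ' x = 1 ∧ τ' y = 1 then a (Function.update τ' x 0) ^ 2 else 0) :=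
    Finset.single_le_sum (f := fun τ' : V → Fin 2 =>
        (if τ' x = 1 ∧ τ' y = 1 then a (Function.update τ' x 0) ^ 2 else 0))
      (fun τ' _ => by
        show (0 : ℝ) ≤ (if τ' x = 1 ∧ τ' y = 1 then a (Function.update τ' x 0) ^ 2 else 0)
        split_ifs
        · exact sq_nonneg _
        · exact le_rfl) (Finset.mem_univ τ)
  rw [if_pos h] at hle
  exact lt_of_lt_of_le (pow_pos (hpos _) 2) hle

/-- **J1 (one-state KL = mean log-amplitude shift).**  For a positive amplitude with `a_{yx} = a_{xy}`
(e.g. uniform density, `pairMass_symm_of_siteDensity`):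
`KL(ν_x^{(y)} ‖ ν_y^{(x)}) = E_{ν_x^{(y)}} [2 log ψ(τ+x) − 2 log ψ(τ+y)]` — the normalisations cancel and the
log-likelihood ratio is (minus twice) the teleportation log-ratio `h`. Theory seat memo ROTOR-THEORY-9 §135. [folklore] -/
theorem klDiv_teleLaw_eq (a : (V → Fin 2) → ℝ) (hpos : ∀ σ, 0 < a σ) (x y : V)
    (hm : pairMass a y x = pairMass a x y) :
    klDiv (teleLaw a x y) (teleLaw a y x)
      = ∑ τ, teleLaw a x y τ *
          (2 * Real.log (a (Function.update τ x 0)) - 2 * Real.log (a (Function.update τ y 0))) := by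
  unfold klDiv
  refine Finset.sum_congr rfl fun τ _ => ?_
  by_cases h : τ x = 1 ∧ τ y = 1
  · have hm0 : 0 < pairMass a x y := pairMass_pos_of_pos a hpos x y τ h
    have hp : teleLaw a x y τ = a (Function.update τ x 0) ^ 2 / pairMass a x y := by
      unfold teleLaw; rw [if_pos h]
    have hq : teleLaw a y x τ = a (Function.update τ y 0) ^ 2 / pairMass a x y := by
      unfold teleLaw; rw [if_pos ⟨h.2, h.1⟩, hm]
    rw [hp, hq]
    have hax : 0 < a (Function.update τ x 0) := hpos _
    have hay : 0 < a (Function.update τ y 0) := hpos _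
    have hratio : a (Function.update τ x 0) ^ 2 / pairMass a x y / (a (Function.update τ y 0) ^ 2 / pairMass a x y)
        = a (Function.update τ x 0) ^ 2 / a (Function.update τ y 0) ^ 2 := by
      field_simp
    rw [hratio, Real.log_div (ne_of_gt (pow_pos hax 2)) (ne_of_gt (pow_pos hay 2)), Real.log_pow, Real.log_pow]
    push_cast
    ring
  · have hp : teleLaw a x y τ = 0 := by unfold teleLaw; rw [if_neg h]
    rw [hp, zero_mul, zero_mul]

/-- Spectator potential `Φ_τ(x) = Σ_z n_z(τ) w(z,x)` (`n_z = occ`, the tree's occupation indicator).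
(theory seat `hubbard-h0-rotor-theory-1`, memo ROTOR-THEORY-9 §135) [folklore] -/
def spectatorField (w : V → V → ℝ) (τ : V → Fin 2) (x : V) : ℝ := ∑ z, occ τ z * w z x

/-- Jastrow log-weight `J(σ) = Σ_u Σ_v n_u n_v w(u,v)` (= `2 Σ_{pairs} w` plus the diagonal, for symmetric `w`).
(theory seat `hubbard-h0-rotor-theory-1`, memo ROTOR-THEORY-9 §135) [folklore] -/
def jastrowLogWeight (w : V → V → ℝ) (σ : V → Fin 2) : ℝ :=
  ∑ u, occ σ u * spectatorField w σ u

/-- Jastrow (Rokhsar–Kivelson) amplitude `ψ_w(σ) = exp(−J(σ)/4)`, i.e. `|ψ_w|² = exp(−Σ_{pairs} w)` is the Gibbs weight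
of the classical lattice gas with pair potential `w`. (theory seat `hubbard-h0-rotor-theory-1`, memo ROTOR-THEORY-9 §135) [folklore] -/
def jastrowAmp (w : V → V → ℝ) (σ : V → Fin 2) : ℝ := Real.exp (-(jastrowLogWeight w σ) / 4)

omit [Fintype V] in
/-- Adding a particle at `x` raises the indicator at `x` from `0` to `1`. [folklore] -/
theorem occ_update (τ : V → Fin 2) (x : V) (hx : τ x = 1) (u : V) :
    occ (Function.update τ x 0) u = occ τ u + if u = x then 1 else 0 := by
  unfold occ
  by_cases h : u = x
  · subst h; simp [hx]
  · simp [h]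

/-- Adding a particle at `x` shifts every spectator potential by `w(x,·)`. [folklore] -/
theorem spectatorField_update (w : V → V → ℝ) (τ : V → Fin 2) (x : V) (hx : τ x = 1) (u : V) :
    spectatorField w (Function.update τ x 0) u = spectatorField w τ u + w x u := by
  unfold spectatorField
  simp_rw [occ_update τ x hx, add_mul, Finset.sum_add_distrib, ite_mul, one_mul, zero_mul]
  rw [Finset.sum_ite_eq' Finset.univ x (fun z => w z u)]
  simp

/-- Adding a particle at `x` to `τ` raises the Jastrow log-weight by twice the spectator potential at `x` plus the
diagonal (chemical-potential) term `w(x,x)` (symmetric `w`). [folklore] -/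
theorem jastrowLogWeight_update (w : V → V → ℝ) (hw : ∀ u v, w u v = w v u)
    (τ : V → Fin 2) (x : V) (hx : τ x = 1) :
    jastrowLogWeight w (Function.update τ x 0) = jastrowLogWeight w τ + 2 * spectatorField w τ x + w x x := by
  unfold jastrowLogWeight
  simp_rw [spectatorField_update w τ x hx, occ_update τ x hx, add_mul, mul_add, Finset.sum_add_distrib,
    ite_mul, one_mul, zero_mul]
  rw [Finset.sum_ite_eq' Finset.univ x (fun u => spectatorField w τ u),
    Finset.sum_ite_eq' Finset.univ x (fun u => w x u)]
  simp only [Finset.mem_univ, if_true]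
  have h1 : ∑ u, occ τ u * w x u = spectatorField w τ x := by
    unfold spectatorField
    exact Finset.sum_congr rfl fun u _ => by rw [hw x u]
  rw [h1]
  ring

omit [DecidableEq V] in
/-- `2 log ψ_w = −J/2`. [folklore] -/
theorem two_mul_log_jastrowAmp (w : V → V → ℝ) (σ : V → Fin 2) :
    2 * Real.log (jastrowAmp w σ) = -(jastrowLogWeight w σ) / 2 := by
  unfold jastrowAmp; rw [Real.log_exp]; ring

omit [DecidableEq V] in
/-- Jastrow amplitudes are positive. [folklore] -/
theorem jastrowAmp_pos (w : V → V → ℝ) (σ : V → Fin 2) : 0 < jastrowAmp w σ := Real.exp_pos _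

/-- **J2 — TELEPORTATION ENTROPY OF A JASTROW STATE = MEAN SPECTATOR POTENTIAL SHIFT.**
`KL(ν_x^{(y)} ‖ ν_y^{(x)}) = E_{ν_x^{(y)}} [Φ_τ(y) − Φ_τ(x)]`: the relative entropy that decides condensation
(`TeleEntropyBound`) is the mean interaction-potential difference, felt by the spectators of the classical gas
`|ψ_w|²` conditioned on «particle at `x`, vacancy at `y`», between the vacancy site and the particle site —
a SCREENING quantity (bounded iff the pinned unit defect is screened at summable cost; `≍ w(0) − w(x−y)`-type
growth, i.e. `β log|x−y|`, for the unscreenable log gas = Magro–Ceperley / Tonks). Theory seat memo ROTOR-THEORY-9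
§135. [folklore] -/
theorem klDiv_teleLaw_jastrow (w : V → V → ℝ) (hw : ∀ u v, w u v = w v u) (x y : V) (hμ : w x x = w y y)
    (hm : pairMass (jastrowAmp w) y x = pairMass (jastrowAmp w) x y) :
    klDiv (teleLaw (jastrowAmp w) x y) (teleLaw (jastrowAmp w) y x)
      = ∑ τ, teleLaw (jastrowAmp w) x y τ * (spectatorField w τ y - spectatorField w τ x) := by
  rw [klDiv_teleLaw_eq (jastrowAmp w) (jastrowAmp_pos w) x y hm]
  refine Finset.sum_congr rfl fun τ _ => ?_
  by_cases h : τ x = 1 ∧ τ y = 1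
  · rw [two_mul_log_jastrowAmp, two_mul_log_jastrowAmp, jastrowLogWeight_update w hw τ x h.1,
      jastrowLogWeight_update w hw τ y h.2, hμ]
    ring
  · have hp : teleLaw (jastrowAmp w) x y τ = 0 := by unfold teleLaw; rw [if_neg h]
    rw [hp, zero_mul, zero_mul]

/-- **Corollary (screening bound ⇒ teleportation entropy bound).**  If the spectator potential difference is
bounded by `B` on the support, the teleportation KL is `≤ B`; e.g. every FINITE-RANGE Jastrow state has bounded
teleportation entropies, hence (one-state E-floor) a condensate fraction `≥ ρ(1−ρ)e^{−B/2}` in ANY dimension.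
Theory seat memo ROTOR-THEORY-9 §135. [folklore] -/
theorem klDiv_teleLaw_jastrow_le (w : V → V → ℝ) (hw : ∀ u v, w u v = w v u) (x y : V) (hμ : w x x = w y y)
    (hm : pairMass (jastrowAmp w) y x = pairMass (jastrowAmp w) x y)
    (hm0 : 0 < pairMass (jastrowAmp w) x y) (B : ℝ)
    (hB : ∀ τ : V → Fin 2, τ x = 1 → τ y = 1 → spectatorField w τ y - spectatorField w τ x ≤ B) :
    klDiv (teleLaw (jastrowAmp w) x y) (teleLaw (jastrowAmp w) y x) ≤ B := by
  rw [klDiv_teleLaw_jastrow w hw x y hμ hm]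
  calc ∑ τ, teleLaw (jastrowAmp w) x y τ * (spectatorField w τ y - spectatorField w τ x)
      ≤ ∑ τ, teleLaw (jastrowAmp w) x y τ * B := by
        refine Finset.sum_le_sum fun τ _ => ?_
        by_cases h : τ x = 1 ∧ τ y = 1
        · exact mul_le_mul_of_nonneg_left (hB τ h.1 h.2) (teleLaw_nonneg _ x y τ)
        · have hp : teleLaw (jastrowAmp w) x y τ = 0 := by unfold teleLaw; rw [if_neg h]
          rw [hp, zero_mul, zero_mul]
    _ = B := by rw [← Finset.sum_mul, sum_teleLaw _ x y hm0, one_mul]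

omit [DecidableEq V] in
/-- Relabelling a configuration by a `w`-preserving bijection moves the spectator potential along. [folklore] -/
theorem spectatorField_comp_equiv (w : V → V → ℝ) (r : V ≃ V) (hr : ∀ u v, w (r u) (r v) = w u v)
    (σ : V → Fin 2) (u : V) : spectatorField w (σ ∘ r) u = spectatorField w σ (r u) := by
  unfold spectatorField
  have hocc : ∀ z, occ (σ ∘ r) z = occ σ (r z) := fun z => rfl
  simp_rw [hocc]
  rw [← Equiv.sum_comp r (fun z => occ σ z * w z (r u))]
  simp_rw [hr]

omit [DecidableEq V] in
/-- The Jastrow log-weight is invariant under `w`-preserving relabellings. [folklore] -/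
theorem jastrowLogWeight_comp_equiv (w : V → V → ℝ) (r : V ≃ V) (hr : ∀ u v, w (r u) (r v) = w u v)
    (σ : V → Fin 2) : jastrowLogWeight w (σ ∘ r) = jastrowLogWeight w σ := by
  unfold jastrowLogWeight
  simp_rw [spectatorField_comp_equiv w r hr σ]
  have hocc : ∀ u, occ (σ ∘ r) u = occ σ (r u) := fun u => rfl
  simp_rw [hocc]
  exact Equiv.sum_comp r (fun u => occ σ u * spectatorField w σ u)

omit [DecidableEq V] in
/-- The Jastrow amplitude is invariant under `w`-preserving relabellings. [folklore] -/
theorem jastrowAmp_comp_equiv (w : V → V → ℝ) (r : V ≃ V) (hr : ∀ u v, w (r u) (r v) = w u v)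
    (σ : V → Fin 2) : jastrowAmp w (σ ∘ r) = jastrowAmp w σ := by
  unfold jastrowAmp; rw [jastrowLogWeight_comp_equiv w r hr σ]

/-- **Pair-mass symmetry from a reflection.**  If a `w`-preserving bijection swaps `x` and `y`, then `a_{yx} = a_{xy}` for the
Jastrow amplitude (on the torus: `z ↦ x + y − z`). Theory seat memo ROTOR-THEORY-9 §135. [folklore] -/
theorem pairMass_symm_of_reflection (w : V → V → ℝ) (x y : V) (r : V ≃ V) (hrx : r x = y) (hry : r y = x)
    (hr : ∀ u v, w (r u) (r v) = w u v) :
    pairMass (jastrowAmp w) y x = pairMass (jastrowAmp w) x y := by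
  unfold pairMass
  rw [← Equiv.sum_comp (Equiv.arrowCongr r.symm (Equiv.refl (Fin 2)))
    (fun τ => if τ y = 1 ∧ τ x = 1 then jastrowAmp w (Function.update τ y 0) ^ 2 else 0)]
  refine Finset.sum_congr rfl fun τ _ => ?_
  have he : (Equiv.arrowCongr r.symm (Equiv.refl (Fin 2))) τ = τ ∘ r := by
    ext z; simp [Equiv.arrowCongr_apply]
  rw [he]
  simp only [Function.comp_apply, hrx, hry]
  by_cases h : τ x = 1 ∧ τ y = 1
  · rw [if_pos h, if_pos h]
    have hu : Function.update (τ ∘ r) y 0 = Function.update τ x 0 ∘ r := by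
      rw [← hry, Function.update_comp_eq_of_injective τ r.injective y 0]
    rw [hu, jastrowAmp_comp_equiv w r hr]
  · rw [if_neg h, if_neg h]

/-! ### Part G — the entropy as a functional of the conditioned density / screening cloud -/

/-- Conditioned occupation: the `teleLaw`-mean of the particle indicator at `z` (law of the spectators given
«particle at `x`, vacancy at `y`»). (theory seat `hubbard-h0-rotor-theory-1`, memo ROTOR-THEORY-9 §135) [folklore] -/
def condOcc (a : (V → Fin 2) → ℝ) (x y z : V) : ℝ := ∑ τ, teleLaw a x y τ * occ τ z

/-- **J3.** For a Jastrow state the vacancy-insertion entropy is a LINEAR functional of the conditioned density: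
`KL = Σ_z condOcc(z) · (w(z,y) − w(z,x))`. Theory seat memo ROTOR-THEORY-9 §135. [folklore] -/
theorem klDiv_teleLaw_jastrow_density (w : V → V → ℝ) (hw : ∀ u v, w u v = w v u) (x y : V) (hμ : w x x = w y y)
    (hm : pairMass (jastrowAmp w) y x = pairMass (jastrowAmp w) x y) :
    klDiv (teleLaw (jastrowAmp w) x y) (teleLaw (jastrowAmp w) y x)
      = ∑ z, condOcc (jastrowAmp w) x y z * (w z y - w z x) := by
  rw [klDiv_teleLaw_jastrow w hw x y hμ hm]
  unfold spectatorField condOcc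
  calc ∑ τ, teleLaw (jastrowAmp w) x y τ * (∑ z, occ τ z * w z y - ∑ z, occ τ z * w z x)
      = ∑ τ, ∑ z, teleLaw (jastrowAmp w) x y τ * occ τ z * (w z y - w z x) := by
        refine Finset.sum_congr rfl fun τ _ => ?_
        rw [← Finset.sum_sub_distrib, Finset.mul_sum]
        refine Finset.sum_congr rfl fun z _ => ?_
        ring
    _ = ∑ z, ∑ τ, teleLaw (jastrowAmp w) x y τ * occ τ z * (w z y - w z x) := Finset.sum_comm
    _ = ∑ z, (∑ τ, teleLaw (jastrowAmp w) x y τ * occ τ z) * (w z y - w z x) := by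
        refine Finset.sum_congr rfl fun z _ => ?_
        rw [Finset.sum_mul]

/-- Translation: a difference kernel sums to the same value around any centre. [folklore] -/
theorem sum_sub_kernel_eq {G : Type} [AddCommGroup G] [Fintype G] (W : G → ℝ) (x y : G) :
    ∑ z, (W (z - y) - W (z - x)) = 0 := by
  rw [Finset.sum_sub_distrib]
  have h1 : ∑ z, W (z - y) = ∑ z, W z := Fintype.sum_equiv (Equiv.subRight y) _ _ (fun z => rfl)
  have h2 : ∑ z, W (z - x) = ∑ z, W z := Fintype.sum_equiv (Equiv.subRight x) _ _ (fun z => rfl)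
  rw [h1, h2, sub_self]

/-- **J3′.** With a translation-invariant pair potential `w(u,v) = W(u − v)` the functional only sees the SCREENING CLOUD
`condOcc − m` (any constant background `m` drops out). Theory seat memo ROTOR-THEORY-9 §135. [folklore] -/
theorem klDiv_teleLaw_jastrow_cloud {G : Type} [AddCommGroup G] [Fintype G] [DecidableEq G]
    (W : G → ℝ) (hW : ∀ v, W (-v) = W v) (x y : G)
    (hm : pairMass (jastrowAmp fun u v => W (u - v)) y x = pairMass (jastrowAmp fun u v => W (u - v)) x y)
    (m : ℝ) :
    klDiv (teleLaw (jastrowAmp fun u v => W (u - v)) x y) (teleLaw (jastrowAmp fun u v => W (u - v)) y x)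
      = ∑ z, (condOcc (jastrowAmp fun u v => W (u - v)) x y z - m) * (W (z - y) - W (z - x)) := by
  have hw : ∀ u v : G, W (u - v) = W (v - u) := fun u v => by rw [← hW (u - v), neg_sub]
  have hμ : W (x - x) = W (y - y) := by simp
  rw [klDiv_teleLaw_jastrow_density (fun u v => W (u - v)) hw x y hμ hm]
  have h0 := sum_sub_kernel_eq W x y
  have : ∑ z, (condOcc (jastrowAmp fun u v => W (u - v)) x y z - m) * (W (z - y) - W (z - x))
      = ∑ z, condOcc (jastrowAmp fun u v => W (u - v)) x y z * (W (z - y) - W (z - x))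
        - m * ∑ z, (W (z - y) - W (z - x)) := by
    rw [Finset.mul_sum, ← Finset.sum_sub_distrib]
    refine Finset.sum_congr rfl fun z _ => ?_
    ring
  rw [this, h0, mul_zero, sub_zero]

end OneStateJastrow

end Summit.HubbardSuperconductivity.HubbardSuperconductivity.Theorems.AnisotropyChord.InsertionEntropy
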